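import Summits.QuantumFields.QCD.Theorems.SmallFieldUltracontractivity.Negative.Tightness
import Summits.QuantumFields.QCD.Theorems.HeatSlicedQuarksDaviesGaffneyWilsonRange
import Summits.QuantumFields.QCD.Theorems.SpectralDefectExtinctionTipNoBindingFreeSymbol
import Literature.Barriers.QuantumFields.WilsonDeterminantMassSplitting
import Literature.MathematicalPhysics.QuantumLattice.GrassmannIntegralWilsonProofs
import Literature.MathematicalPhysics.QuantumLattice.LatticeToriProofs
import Literature.Probability.LatticeModels.TorusFourierProofs

/-!
# Local commutator bound for stub `stub_commutatorBound` of line `point-centred-axial-parabolic`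
(crux `Summit.QuantumFields.QCD.Theses.HeatSlicedQuarks.SmallFieldUltracontractivity`, item stmt-QuantumFields-8871)

Second auxiliary file of the stub (registered auxiliary stub `stub_commutatorBoundLocal`).  For the
FREE massive Wilson operator `D₁ = D₀ + m` (`U ≡ 1`, `r = 1`) and `H₁ = D₁ᴴ D₁` on the four-torus:

* `CommutatorBound.free_mulVec_apply`, `CommutatorBound.free_conjTranspose_mulVec_apply` — `D₀`
  and (by `γ₅`-hermiticity `D₀ᴴ = γ₅ D₀ γ₅`) `D₀ᴴ` are nearest-neighbour DIFFERENCE operators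
  `½ Σ_μ Σ_β [P_μ (ψ(z) - ψ(z + μ̂)) + Q_μ (ψ(z) - ψ(z - μ̂))]` with the Wilson projectors
  `(P, Q) = (1 - γ_μ, 1 + γ_μ)`, resp. `(1 + γ_μ, 1 - γ_μ)` (they kill site-constant spinors);
* `CommutatorBound.comm_formula` — the commutator of such an operator with a site function `χ`;
* `stub_commutatorBoundLocal` — for `|m| ≤ 1`, a site function `χ` with unit-step differences
  `≤ A₁` and two-step second differences `≤ A₂`, and a spinor field `u` with `|u| ≤ B₀` and
  unit-step differences `≤ B₁` on the unit ball about `z`: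
  `|(H₁(χu))(z,a,α) - χ(z) (H₁u)(z,a,α)| ≤ 2056 (A₂ B₀ + A₁ B₁)`, from
  `H₁ = D₀ᴴD₀ + m (D₀ + D₀ᴴ) + m²`, `[D₀ᴴD₀, χ] = D₀ᴴ [D₀, χ] + [D₀ᴴ, χ] D₀` (second differences of
  `χ` times `u` plus first differences of `χ` times first differences of `u`) and the cancellation
  of the `γ`-terms in `D₀ + D₀ᴴ` (`sum_two_hops`), which leaves a discrete Laplacian of `χ`.

Pure theorem file; no named facts beyond the discharged `wilsonDirac_gammaFive_hermitian_holds`.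
-/

noncomputable section

namespace Summit.QuantumFields.QCD.Cruxes.SmallFieldUltracontractivity.PointCentredAxialParabolic

open Literature.MathematicalPhysics.QuantumLattice Literature.MathematicalPhysics.QuantumFieldTheory
open Literature.Probability.LatticeModels (TorusSite torusChar)
open Summit.QuantumFields.QCD.Theorems.SmallFieldUltracontractivity.Negative
open scoped Matrix ComplexConjugate

open Summit.QuantumFields.QCD.Theorems.HeatSlicedQuarksDaviesGaffney
open Summit.QuantumFields.QCD.Cruxes.TipNoBinding.PositivityNoLeakSpread (wilsonDirac_one_mulVec_apply)
open Literature.Barriers.QuantumFields (wilsonDirac_add_mass)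

namespace CommutatorBound

/-- Bound of a hopping sum with coefficients of modulus `≤ 2`. -/
theorem half_sum_bound {P Q : Fin 4 → Matrix (Fin 4) (Fin 4) ℂ} (hP : ∀ μ α β, ‖P μ α β‖ ≤ 2)
    (hQ : ∀ μ α β, ‖Q μ α β‖ ≤ 2) {X Y : Fin 4 → Fin 4 → ℂ} {M : ℝ} (hX : ∀ μ β, ‖X μ β‖ ≤ M)
    (hY : ∀ μ β, ‖Y μ β‖ ≤ M) (α : Fin 4) :
    ‖(1 / 2 : ℂ) * ∑ μ, ∑ β, (P μ α β * X μ β + Q μ α β * Y μ β)‖ ≤ 32 * M := by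
  rw [norm_mul, show ‖(1 / 2 : ℂ)‖ = 1 / 2 by norm_num]
  have h : ∀ μ β, ‖P μ α β * X μ β + Q μ α β * Y μ β‖ ≤ 4 * M := fun μ β => by
    refine (norm_add_le _ _).trans ?_
    rw [norm_mul, norm_mul]
    nlinarith [hP μ α β, hQ μ α β, hX μ β, hY μ β, norm_nonneg (P μ α β), norm_nonneg (Q μ α β),
      norm_nonneg (X μ β), norm_nonneg (Y μ β)]
  calc _ ≤ 1 / 2 * ∑ _μ : Fin 4, ∑ _β : Fin 4, 4 * M := by
        gcongr
        exact (norm_sum_le _ _).trans (Finset.sum_le_sum fun μ _ =>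
          (norm_sum_le _ _).trans (Finset.sum_le_sum fun β _ => h μ β))
    _ = 32 * M := by simp only [Finset.sum_const, Finset.card_univ, Fintype.card_fin]; ring

/-- Bound of a difference of two hopping sums. -/
theorem half_sum_sub_bound {P Q : Fin 4 → Matrix (Fin 4) (Fin 4) ℂ} (hP : ∀ μ α β, ‖P μ α β‖ ≤ 2)
    (hQ : ∀ μ α β, ‖Q μ α β‖ ≤ 2) {X Y X' Y' : Fin 4 → Fin 4 → ℂ} {M : ℝ}
    (hX : ∀ μ β, ‖X μ β - X' μ β‖ ≤ M) (hY : ∀ μ β, ‖Y μ β - Y' μ β‖ ≤ M) (α : Fin 4) :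
    ‖(1 / 2 : ℂ) * ∑ μ, ∑ β, (P μ α β * X μ β + Q μ α β * Y μ β) -
        (1 / 2 : ℂ) * ∑ μ, ∑ β, (P μ α β * X' μ β + Q μ α β * Y' μ β)‖ ≤ 32 * M := by
  rw [← mul_sub, ← Finset.sum_sub_distrib]
  convert half_sum_bound hP hQ hX hY α using 4
  rw [← Finset.sum_sub_distrib]
  exact Finset.sum_congr rfl fun β _ => by ring

/-- `4 c_α - ½ Σ_μ Σ_β (P c₊ + Q c₋) = ½ Σ_μ Σ_β (P (c - c₊) + Q (c - c₋))` when `P_μ + Q_μ = 2`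
(a hopping operator with this normalisation kills site-constant spinors). -/
theorem four_sub_half_sum {P Q : Fin 4 → Matrix (Fin 4) (Fin 4) ℂ}
    (hPQ : ∀ μ α β, P μ α β + Q μ α β = if α = β then 2 else 0) (c : Fin 4 → ℂ)
    (p q : Fin 4 → Fin 4 → ℂ) (α : Fin 4) :
    4 * c α - (1 / 2 : ℂ) * ∑ μ, ∑ β, (P μ α β * p μ β + Q μ α β * q μ β) =
      (1 / 2 : ℂ) * ∑ μ, ∑ β, (P μ α β * (c β - p μ β) + Q μ α β * (c β - q μ β)) := by
  have h1 : ∀ μ, ∑ β, (P μ α β * (c β - p μ β) + Q μ α β * (c β - q μ β)) =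
      2 * c α - ∑ β, (P μ α β * p μ β + Q μ α β * q μ β) := by
    intro μ
    have h2 : ∑ β, (P μ α β + Q μ α β) * c β = 2 * c α := by
      simp_rw [hPQ, ite_mul, zero_mul, Finset.sum_ite_eq, Finset.mem_univ, if_true]
    rw [← h2, ← Finset.sum_sub_distrib]
    exact Finset.sum_congr rfl fun β _ => by ring
  simp_rw [h1]
  rw [Finset.sum_sub_distrib]
  simp only [Finset.sum_const, Finset.card_univ, Fintype.card_fin]
  ring

/-- Product rule for differences. -/
theorem norm_mul_sub_mul_le' (a b a' b' : ℂ) :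
    ‖a * b - a' * b'‖ ≤ ‖a - a'‖ * ‖b‖ + ‖a'‖ * ‖b - b'‖ := by
  calc ‖a * b - a' * b'‖ = ‖(a - a') * b + a' * (b - b')‖ := by ring_nf
    _ ≤ _ := (norm_add_le _ _).trans (by rw [norm_mul, norm_mul])

section Free

variable {L : ℕ} [NeZero L]

/-- The Wilson spin projectors: `(1 - γ_μ) + (1 + γ_μ) = 2`, entries of modulus `≤ 2`, and the
`γ₅`-sign conjugation exchanging them. -/
theorem proj_facts (μ α β : Fin 4) :
    ((1 - euclideanGamma μ) α β + (1 + euclideanGamma μ) α β = if α = β then 2 else 0) ∧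
    ‖(1 - euclideanGamma μ) α β‖ ≤ 2 ∧ ‖(1 + euclideanGamma μ) α β‖ ≤ 2 ∧
    (![1, 1, -1, -1] : Fin 4 → ℂ) α * (1 - euclideanGamma μ) α β * (![1, 1, -1, -1] : Fin 4 → ℂ) β =
      (1 + euclideanGamma μ) α β ∧
    (![1, 1, -1, -1] : Fin 4 → ℂ) α * (1 + euclideanGamma μ) α β * (![1, 1, -1, -1] : Fin 4 → ℂ) β =
      (1 - euclideanGamma μ) α β := by
  have hγ := norm_euclideanGamma_apply_le μ α β
  have h5 := gammaFiveSign_mul_euclideanGamma_mul_gammaFiveSign μ α β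
  refine ⟨?_, ?_, ?_, ?_, ?_⟩
  · rw [Matrix.sub_apply, Matrix.add_apply, Matrix.one_apply]; split_ifs <;> ring
  · rw [Matrix.sub_apply, Matrix.one_apply]
    refine (norm_sub_le _ _).trans ?_
    split_ifs <;> simp <;> linarith
  · rw [Matrix.add_apply, Matrix.one_apply]
    refine (norm_add_le _ _).trans ?_
    split_ifs <;> simp <;> linarith
  · rw [Matrix.sub_apply, Matrix.add_apply, Matrix.one_apply, mul_sub, sub_mul, h5]
    by_cases h : α = β
    · subst h; rw [if_pos rfl, mul_one, gammaFiveSign_mul_self]; ring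
    · rw [if_neg h]; ring
  · rw [Matrix.sub_apply, Matrix.add_apply, Matrix.one_apply, mul_add, add_mul, h5]
    by_cases h : α = β
    · subst h; rw [if_pos rfl, mul_one, gammaFiveSign_mul_self]; ring
    · rw [if_neg h]; ring

/-- In `D₀ + D₀ᴴ` the `γ`-terms cancel: the two hopping sums with exchanged projectors add up to
the spin-diagonal Wilson term `Σ_μ (X_μ + Y_μ)`. -/
theorem sum_two_hops (X Y : Fin 4 → Fin 4 → ℂ) (α : Fin 4) :
    (1 / 2 : ℂ) * ∑ μ, ∑ β, ((1 + euclideanGamma μ) α β * X μ β +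
        (1 - euclideanGamma μ) α β * Y μ β) +
        (1 / 2 : ℂ) * ∑ μ, ∑ β, ((1 - euclideanGamma μ) α β * X μ β +
          (1 + euclideanGamma μ) α β * Y μ β) = ∑ μ, (X μ α + Y μ α) := by
  rw [← mul_add, ← Finset.sum_add_distrib, Finset.mul_sum]
  refine Finset.sum_congr rfl fun μ _ => ?_
  have h : ∀ β, (1 + euclideanGamma μ) α β * X μ β + (1 - euclideanGamma μ) α β * Y μ β +
      ((1 - euclideanGamma μ) α β * X μ β + (1 + euclideanGamma μ) α β * Y μ β) =
      (if α = β then 2 else 0) * (X μ β + Y μ β) := fun β => by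
    rw [← (proj_facts μ α β).1]; ring
  rw [← Finset.sum_add_distrib]
  simp_rw [h, ite_mul, zero_mul, Finset.sum_ite_eq, Finset.mem_univ, if_true]
  ring

/-- **The free massless Wilson–Dirac operator as a hopping (difference) operator**:
`(D₀ψ)(z,a,α) = ½ Σ_μ Σ_β [(1 - γ_μ)_{αβ}(ψ(z,a,β) - ψ(z+μ̂,a,β))`
`+ (1 + γ_μ)_{αβ}(ψ(z,a,β) - ψ(z-μ̂,a,β))]`. -/
theorem free_mulVec_apply (ψ : TorusSite 4 L × Fin 3 × Fin 4 → ℂ) (z : TorusSite 4 L) (a : Fin 3)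
    (α : Fin 4) :
    (wilsonDirac (fundamentalRep (Fin 3)) (freeCfg L) 0 1 *ᵥ ψ) (z, a, α) =
      (1 / 2 : ℂ) * ∑ μ, ∑ β, ((1 - euclideanGamma μ) α β *
        (ψ (z, a, β) - ψ (z + Pi.single μ 1, a, β)) +
        (1 + euclideanGamma μ) α β * (ψ (z, a, β) - ψ (z + Pi.single μ (-1), a, β))) := by
  have h := wilsonDirac_one_mulVec_apply ψ z a α
  have hsub : ∀ (y : TorusSite 4 L) (μ : Fin 4), y - Pi.single μ 1 = y + Pi.single μ (-1) :=
    fun y μ => by rw [sub_eq_add_neg, Pi.single_neg]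
  simp only [hsub] at h
  rw [show (1 : GaugeConfig 4 L SU3) = freeCfg L from rfl] at h
  rw [h]
  exact four_sub_half_sum (fun μ α β => (proj_facts μ α β).1) (fun β => ψ (z, a, β))
    (fun μ β => ψ (z + Pi.single μ 1, a, β)) (fun μ β => ψ (z + Pi.single μ (-1), a, β)) α

/-- **Its adjoint** (`γ₅`-hermiticity: `D₀ᴴ = γ₅ D₀ γ₅`) is the hopping operator with the projectors
exchanged: `(D₀ᴴψ)(z,a,α) = ½ Σ_μ Σ_β [(1 + γ_μ)_{αβ}(ψ(z,a,β) - ψ(z+μ̂,a,β))`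
`+ (1 - γ_μ)_{αβ}(ψ(z,a,β) - ψ(z-μ̂,a,β))]`. -/
theorem free_conjTranspose_mulVec_apply (ψ : TorusSite 4 L × Fin 3 × Fin 4 → ℂ) (z : TorusSite 4 L)
    (a : Fin 3) (α : Fin 4) :
    ((wilsonDirac (fundamentalRep (Fin 3)) (freeCfg L) 0 1)ᴴ *ᵥ ψ) (z, a, α) =
      (1 / 2 : ℂ) * ∑ μ, ∑ β, ((1 + euclideanGamma μ) α β *
        (ψ (z, a, β) - ψ (z + Pi.single μ 1, a, β)) +
        (1 - euclideanGamma μ) α β * (ψ (z, a, β) - ψ (z + Pi.single μ (-1), a, β))) := by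
  have hΓ := wilsonDirac_gammaFive_hermitian_holds (fundamentalRep (Fin 3))
    fundamentalRep_mem_unitaryGroup (freeCfg L) 0 1
  rw [← hΓ, spinorLift_gammaFive_eq_diagonal, ← Matrix.mulVec_mulVec, ← Matrix.mulVec_mulVec,
    Matrix.mulVec_diagonal, free_mulVec_apply]
  simp only [Matrix.mulVec_diagonal]
  rw [Finset.mul_sum, Finset.mul_sum, Finset.mul_sum]
  refine Finset.sum_congr rfl fun μ _ => ?_
  rw [Finset.mul_sum, Finset.mul_sum, Finset.mul_sum]
  refine Finset.sum_congr rfl fun β _ => ?_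
  linear_combination (1 / 2 : ℂ) * (ψ (z, a, β) - ψ (z + Pi.single μ 1, a, β)) *
    (proj_facts μ α β).2.2.2.1 + (1 / 2 : ℂ) * (ψ (z, a, β) - ψ (z + Pi.single μ (-1), a, β)) *
    (proj_facts μ α β).2.2.2.2

end Free

section Local

variable {L : ℕ} [NeZero L]

omit [NeZero L] in
/-- Commutator of a hopping operator `T` (coefficients `P`, `Q`) with multiplication by a site
function `χ`:
`[T, χ]v (z) = ½ Σ_μ Σ_β [P (χ(z) - χ(z+μ̂)) v(z+μ̂) + Q (χ(z) - χ(z-μ̂)) v(z-μ̂)]`. -/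
theorem comm_formula {P Q : Fin 4 → Matrix (Fin 4) (Fin 4) ℂ}
    (T : (TorusSite 4 L × Fin 3 × Fin 4 → ℂ) → TorusSite 4 L × Fin 3 × Fin 4 → ℂ)
    (hT : ∀ v z a α, T v (z, a, α) = (1 / 2 : ℂ) * ∑ μ, ∑ β, (P μ α β * (v (z, a, β) -
      v (z + Pi.single μ 1, a, β)) + Q μ α β * (v (z, a, β) - v (z + Pi.single μ (-1), a, β))))
    (χ : TorusSite 4 L → ℝ) (v : TorusSite 4 L × Fin 3 × Fin 4 → ℂ) (z : TorusSite 4 L) (a : Fin 3)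
    (α : Fin 4) :
    T (fun k => (χ k.1 : ℂ) * v k) (z, a, α) - (χ z : ℂ) * T v (z, a, α) =
      (1 / 2 : ℂ) * ∑ μ, ∑ β, (P μ α β * (((χ z : ℂ) - χ (z + Pi.single μ 1)) *
        v (z + Pi.single μ 1, a, β)) + Q μ α β * (((χ z : ℂ) - χ (z + Pi.single μ (-1))) *
        v (z + Pi.single μ (-1), a, β))) := by
  simp only [hT]
  rw [mul_left_comm, ← mul_sub, Finset.mul_sum, ← Finset.sum_sub_distrib]
  congr 1
  refine Finset.sum_congr rfl fun μ _ => ?_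
  rw [Finset.mul_sum, ← Finset.sum_sub_distrib]
  exact Finset.sum_congr rfl fun β _ => by ring

/-- A unit step moves by torus distance `≤ 1`. -/
theorem torusDist_add_single_le (z : TorusSite 4 L) (μ : Fin 4) {σ : ZMod L}
    (hσ : σ = 1 ∨ σ = -1) : torusDist z (z + Pi.single μ σ) ≤ 1 := by
  rcases hσ with rfl | rfl
  · exact torusDist_self_shift_le z μ
  · have h := torusDist_shift_self_le (z + Pi.single μ (-1 : ZMod L)) μ
    rw [Site.shift, Pi.single_neg, neg_add_cancel_right] at h
    rwa [Pi.single_neg]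

/-- Casts: `‖(r : ℂ) - s‖ = |r - s|`. -/
theorem norm_ofReal_sub (r s : ℝ) : ‖((r : ℂ) - s)‖ = |r - s| := by
  rw [← Complex.ofReal_sub, Complex.norm_real, Real.norm_eq_abs]

end Local

end CommutatorBound

open CommutatorBound in
/-- **Local commutator bound (registered auxiliary stub `stub_commutatorBoundLocal`).**  For the
free massive `H₁ = D₁ᴴD₁` (`D₁ = D₀ + m`, `|m| ≤ 1`), a site function `χ` with unit-step first
differences `≤ A₁` and two-step second differences `≤ A₂`, and a spinor field `u` bounded by `B₀`
with unit-step differences `≤ B₁` on the ball of radius `1` about `z`: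
`|(H₁(χu))(z,a,α) - χ(z)(H₁u)(z,a,α)| ≤ 2056 (A₂B₀ + A₁B₁)`. -/
theorem stub_commutatorBoundLocal : ∀ (L : ℕ) [NeZero L] (m : ℝ), |m| ≤ 1 →
    ∀ (χ : TorusSite 4 L → ℝ) (A₁ A₂ : ℝ),
    (∀ (y : TorusSite 4 L) (μ : Fin 4) (σ : ZMod L), (σ = 1 ∨ σ = -1) →
      |χ (y + Pi.single μ σ) - χ y| ≤ A₁) →
    (∀ (y : TorusSite 4 L) (μ ν : Fin 4) (σ τ : ZMod L), (σ = 1 ∨ σ = -1) → (τ = 1 ∨ τ = -1) →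
      |χ (y + Pi.single μ σ + Pi.single ν τ) - χ (y + Pi.single μ σ) - χ (y + Pi.single ν τ) + χ y|
        ≤ A₂) →
    ∀ (u : TorusSite 4 L × Fin 3 × Fin 4 → ℂ) (z : TorusSite 4 L) (B₀ B₁ : ℝ),
    (∀ y : TorusSite 4 L, torusDist z y ≤ 1 → ∀ (b : Fin 3) (β : Fin 4), ‖u (y, b, β)‖ ≤ B₀) →
    (∀ y : TorusSite 4 L, torusDist z y ≤ 1 → ∀ (b : Fin 3) (β μ : Fin 4) (σ : ZMod L),
      (σ = 1 ∨ σ = -1) → ‖u (y + Pi.single μ σ, b, β) - u (y, b, β)‖ ≤ B₁) →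
    ∀ (a : Fin 3) (α : Fin 4),
    ‖(((wilsonDirac (fundamentalRep (Fin 3)) (freeCfg L) m 1)ᴴ *
          wilsonDirac (fundamentalRep (Fin 3)) (freeCfg L) m 1) *ᵥ fun k => (χ k.1 : ℂ) * u k)
        (z, a, α) -
      (χ z : ℂ) * (((wilsonDirac (fundamentalRep (Fin 3)) (freeCfg L) m 1)ᴴ *
          wilsonDirac (fundamentalRep (Fin 3)) (freeCfg L) m 1) *ᵥ u) (z, a, α)‖ ≤
      2056 * (A₂ * B₀ + A₁ * B₁) := by
  intro L _ m hm χ A₁ A₂ hA₁ hA₂ u z B₀ B₁ hB₀ hB₁ a α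
  have hst : ∀ μ (σ : ZMod L), (σ = 1 ∨ σ = -1) → torusDist z (z + Pi.single μ σ) ≤ 1 :=
    fun μ σ hσ => torusDist_add_single_le z μ hσ
  have hz0 : torusDist z z ≤ 1 := by rw [torusDist_self]; exact zero_le_one
  have hA₁0 : 0 ≤ A₁ := (abs_nonneg _).trans (hA₁ z 0 1 (Or.inl rfl))
  have hA₂0 : 0 ≤ A₂ := (abs_nonneg _).trans (hA₂ z 0 0 1 1 (Or.inl rfl) (Or.inl rfl))
  have hB₀0 : 0 ≤ B₀ := (norm_nonneg _).trans (hB₀ z hz0 a α)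
  have hB₁0 : 0 ≤ B₁ := (norm_nonneg _).trans (hB₁ z hz0 a α 0 1 (Or.inl rfl))
  have h1 : (1 : ZMod L) = 1 ∨ (1 : ZMod L) = -1 := Or.inl rfl
  have hm1 : (-1 : ZMod L) = 1 ∨ (-1 : ZMod L) = -1 := Or.inr rfl
  set S := A₂ * B₀ + A₁ * B₁ with hS
  set D := wilsonDirac (fundamentalRep (Fin 3)) (freeCfg L) 0 1 with hD
  have hD1 : wilsonDirac (fundamentalRep (Fin 3)) (freeCfg L) m 1 = D + (m : ℂ) • 1 := by
    rw [hD, ← wilsonDirac_add_mass, zero_add]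
  have hPn : ∀ μ α β, ‖(1 - euclideanGamma μ) α β‖ ≤ 2 := fun μ α β => (proj_facts μ α β).2.1
  have hQn : ∀ μ α β, ‖(1 + euclideanGamma μ) α β‖ ≤ 2 := fun μ α β => (proj_facts μ α β).2.2.1
  have hH : ∀ (w : TorusSite 4 L × Fin 3 × Fin 4 → ℂ) (j : TorusSite 4 L × Fin 3 × Fin 4),
      (((wilsonDirac (fundamentalRep (Fin 3)) (freeCfg L) m 1)ᴴ *
        wilsonDirac (fundamentalRep (Fin 3)) (freeCfg L) m 1) *ᵥ w) j =
      (Dᴴ *ᵥ (D *ᵥ w)) j + (m : ℂ) * ((Dᴴ *ᵥ w) j + (D *ᵥ w) j) + (m : ℂ) ^ 2 * w j := by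
    intro w j
    rw [hD1, Matrix.conjTranspose_add, Matrix.conjTranspose_smul, Matrix.conjTranspose_one,
      ← Matrix.mulVec_mulVec]
    simp only [Matrix.add_mulVec, Matrix.smul_mulVec, Matrix.one_mulVec, Matrix.mulVec_add,
      Matrix.mulVec_smul, Pi.add_apply, Pi.smul_apply, smul_eq_mul, Complex.star_def,
      Complex.conj_ofReal]
    ring
  set v : TorusSite 4 L × Fin 3 × Fin 4 → ℂ := fun k => (χ k.1 : ℂ) * u k with hv
  set w : TorusSite 4 L × Fin 3 × Fin 4 → ℂ := fun k => (D *ᵥ v) k - (χ k.1 : ℂ) * (D *ᵥ u) k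
    with hw
  -- (b1) `D u` is small near `z`
  have hDu : ∀ y, torusDist z y ≤ 1 → ∀ b β, ‖(D *ᵥ u) (y, b, β)‖ ≤ 32 * B₁ := by
    intro y hy b β
    rw [free_mulVec_apply]
    refine half_sum_bound hPn hQn (fun μ β' => ?_) (fun μ β' => ?_) β <;> rw [norm_sub_rev]
    exacts [hB₁ y hy b β' μ 1 h1, hB₁ y hy b β' μ (-1) hm1]
  -- (b2) unit-step differences of `w = [D, χ]u` at `z`
  have hwf : ∀ y b β, w (y, b, β) = (1 / 2 : ℂ) * ∑ μ, ∑ κ, ((1 - euclideanGamma μ) β κ *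
      (((χ y : ℂ) - χ (y + Pi.single μ 1)) * u (y + Pi.single μ 1, b, κ)) +
      (1 + euclideanGamma μ) β κ * (((χ y : ℂ) - χ (y + Pi.single μ (-1))) *
      u (y + Pi.single μ (-1), b, κ))) := fun y b β =>
    comm_formula (fun f => D *ᵥ f) free_mulVec_apply χ u y b β
  have hX : ∀ (ν μ : Fin 4) (σ ρ : ZMod L), (σ = 1 ∨ σ = -1) → (ρ = 1 ∨ ρ = -1) → ∀ b κ,
      ‖((χ z : ℂ) - χ (z + Pi.single μ ρ)) * u (z + Pi.single μ ρ, b, κ) -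
        ((χ (z + Pi.single ν σ) : ℂ) - χ (z + Pi.single ν σ + Pi.single μ ρ)) *
          u (z + Pi.single ν σ + Pi.single μ ρ, b, κ)‖ ≤ S := by
    intro ν μ σ ρ hσ hρ b κ
    refine (norm_mul_sub_mul_le' _ _ _ _).trans ?_
    have h1 : ‖((χ z : ℂ) - χ (z + Pi.single μ ρ)) -
        ((χ (z + Pi.single ν σ) : ℂ) - χ (z + Pi.single ν σ + Pi.single μ ρ))‖ ≤ A₂ := by
      rw [show ((χ z : ℂ) - χ (z + Pi.single μ ρ)) -
          ((χ (z + Pi.single ν σ) : ℂ) - χ (z + Pi.single ν σ + Pi.single μ ρ)) =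
          ((χ (z + Pi.single ν σ + Pi.single μ ρ) - χ (z + Pi.single ν σ) - χ (z + Pi.single μ ρ) +
            χ z : ℝ) : ℂ) by push_cast; ring, Complex.norm_real, Real.norm_eq_abs]
      exact hA₂ z ν μ σ ρ hσ hρ
    have h2 : ‖u (z + Pi.single μ ρ, b, κ) - u (z + Pi.single ν σ + Pi.single μ ρ, b, κ)‖ ≤ B₁ := by
      rw [norm_sub_rev, add_right_comm]
      exact hB₁ _ (hst μ ρ hρ) b κ ν σ hσ
    have h3 : ‖((χ (z + Pi.single ν σ) : ℂ) - χ (z + Pi.single ν σ + Pi.single μ ρ))‖ ≤ A₁ := by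
      rw [norm_ofReal_sub, abs_sub_comm]; exact hA₁ _ μ ρ hρ
    exact add_le_add (mul_le_mul h1 (hB₀ _ (hst μ ρ hρ) b κ) (norm_nonneg _) hA₂0)
      (mul_le_mul h3 h2 (norm_nonneg _) hA₁0)
  have hwd : ∀ (ν : Fin 4) (σ : ZMod L), (σ = 1 ∨ σ = -1) → ∀ b β,
      ‖w (z, b, β) - w (z + Pi.single ν σ, b, β)‖ ≤ 32 * S := by
    intro ν σ hσ b β
    rw [hwf, hwf]
    exact half_sum_sub_bound hPn hQn (fun μ κ => hX ν μ σ 1 hσ h1 b κ)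
      (fun μ κ => hX ν μ σ (-1) hσ hm1 b κ) β
  -- (b3) the two pieces of `[D₀ᴴD₀, χ]u = D₀ᴴ w + [D₀ᴴ, χ](D₀u)`
  have hT1a : ‖(Dᴴ *ᵥ w) (z, a, α)‖ ≤ 32 * (32 * S) := by
    rw [free_conjTranspose_mulVec_apply]
    exact half_sum_bound hQn hPn (fun μ β => hwd μ 1 h1 a β) (fun μ β => hwd μ (-1) hm1 a β) α
  have hT1b : ‖(Dᴴ *ᵥ fun k => (χ k.1 : ℂ) * (D *ᵥ u) k) (z, a, α) -
      (χ z : ℂ) * (Dᴴ *ᵥ (D *ᵥ u)) (z, a, α)‖ ≤ 32 * (A₁ * (32 * B₁)) := by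
    refine (congrArg norm (comm_formula (fun f => Dᴴ *ᵥ f) free_conjTranspose_mulVec_apply χ
      (D *ᵥ u) z a α)).trans_le ?_
    refine half_sum_bound hQn hPn (fun μ β => ?_) (fun μ β => ?_) α <;>
      rw [norm_mul, norm_ofReal_sub, abs_sub_comm]
    exacts [mul_le_mul (hA₁ z μ 1 h1) (hDu _ (hst μ 1 h1) a β) (norm_nonneg _) hA₁0,
      mul_le_mul (hA₁ z μ (-1) hm1) (hDu _ (hst μ (-1) hm1) a β) (norm_nonneg _) hA₁0]
  have hT1 : ‖(Dᴴ *ᵥ (D *ᵥ v)) (z, a, α) - (χ z : ℂ) * (Dᴴ *ᵥ (D *ᵥ u)) (z, a, α)‖ ≤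
      32 * (32 * S) + 32 * (A₁ * (32 * B₁)) := by
    have hwdef : w = D *ᵥ v - fun k => (χ k.1 : ℂ) * (D *ᵥ u) k := rfl
    have e : (Dᴴ *ᵥ (D *ᵥ v)) (z, a, α) - (χ z : ℂ) * (Dᴴ *ᵥ (D *ᵥ u)) (z, a, α) =
        (Dᴴ *ᵥ w) (z, a, α) + ((Dᴴ *ᵥ fun k => (χ k.1 : ℂ) * (D *ᵥ u) k) (z, a, α) -
          (χ z : ℂ) * (Dᴴ *ᵥ (D *ᵥ u)) (z, a, α)) := by
      rw [hwdef, Matrix.mulVec_sub, Pi.sub_apply]; ring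
    rw [e]
    exact (norm_add_le _ _).trans (add_le_add hT1a hT1b)
  -- (b4) the mass cross term `m [D₀ + D₀ᴴ, χ]u`: a discrete Laplacian of `χ` against `u`
  have h23 : ∀ μ, ‖((χ z : ℂ) - χ (z + Pi.single μ 1)) * u (z + Pi.single μ 1, a, α) +
      ((χ z : ℂ) - χ (z + Pi.single μ (-1))) * u (z + Pi.single μ (-1), a, α)‖ ≤
      A₂ * B₀ + 2 * (A₁ * B₁) := by
    intro μ
    rw [show ((χ z : ℂ) - χ (z + Pi.single μ 1)) * u (z + Pi.single μ 1, a, α) +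
        ((χ z : ℂ) - χ (z + Pi.single μ (-1))) * u (z + Pi.single μ (-1), a, α) =
        (((χ z : ℂ) - χ (z + Pi.single μ 1)) + ((χ z : ℂ) - χ (z + Pi.single μ (-1)))) *
          u (z, a, α) +
        ((χ z : ℂ) - χ (z + Pi.single μ 1)) * (u (z + Pi.single μ 1, a, α) - u (z, a, α)) +
        ((χ z : ℂ) - χ (z + Pi.single μ (-1))) * (u (z + Pi.single μ (-1), a, α) - u (z, a, α))
        by ring]
    refine (norm_add₃_le).trans ?_
    rw [norm_mul, norm_mul, norm_mul, norm_ofReal_sub, norm_ofReal_sub, abs_sub_comm (χ z),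
      abs_sub_comm (χ z)]
    have h2 : ‖((χ z : ℂ) - χ (z + Pi.single μ 1)) + ((χ z : ℂ) - χ (z + Pi.single μ (-1)))‖ ≤
        A₂ := by
      have h := hA₂ z μ μ 1 (-1) h1 hm1
      rw [Pi.single_neg, add_neg_cancel_right, ← Pi.single_neg] at h
      rw [show ((χ z : ℂ) - χ (z + Pi.single μ 1)) + ((χ z : ℂ) - χ (z + Pi.single μ (-1))) =
        ((χ z - χ (z + Pi.single μ 1) - χ (z + Pi.single μ (-1)) + χ z : ℝ) : ℂ) by push_cast; ring,
        Complex.norm_real, Real.norm_eq_abs]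
      exact h
    calc _ ≤ A₂ * B₀ + A₁ * B₁ + A₁ * B₁ :=
          add_le_add_three (mul_le_mul h2 (hB₀ z hz0 a α) (norm_nonneg _) hA₂0)
            (mul_le_mul (hA₁ z μ 1 h1) (hB₁ z hz0 a α μ 1 h1) (norm_nonneg _) hA₁0)
            (mul_le_mul (hA₁ z μ (-1) hm1) (hB₁ z hz0 a α μ (-1) hm1) (norm_nonneg _) hA₁0)
      _ = _ := by ring
  have hT23 : ‖((Dᴴ *ᵥ v) (z, a, α) - (χ z : ℂ) * (Dᴴ *ᵥ u) (z, a, α)) +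
      ((D *ᵥ v) (z, a, α) - (χ z : ℂ) * (D *ᵥ u) (z, a, α))‖ ≤ 4 * (A₂ * B₀ + 2 * (A₁ * B₁)) := by
    have c1 := comm_formula (fun f => Dᴴ *ᵥ f) free_conjTranspose_mulVec_apply χ u z a α
    have c2 := comm_formula (fun f => D *ᵥ f) free_mulVec_apply χ u z a α
    beta_reduce at c1 c2
    rw [c1, c2, sum_two_hops]
    refine (norm_sum_le _ _).trans ?_
    calc _ ≤ ∑ _μ : Fin 4, (A₂ * B₀ + 2 * (A₁ * B₁)) := Finset.sum_le_sum fun μ _ => h23 μ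
      _ = _ := by simp only [Finset.sum_const, Finset.card_univ, Fintype.card_fin]; ring
  -- assembly
  rw [hH, hH, show v (z, a, α) = (χ z : ℂ) * u (z, a, α) from rfl]
  have hmn : ‖(m : ℂ)‖ ≤ 1 := by rw [Complex.norm_real, Real.norm_eq_abs]; exact hm
  calc _ = ‖((Dᴴ *ᵥ (D *ᵥ v)) (z, a, α) - (χ z : ℂ) * (Dᴴ *ᵥ (D *ᵥ u)) (z, a, α)) +
        (m : ℂ) * (((Dᴴ *ᵥ v) (z, a, α) - (χ z : ℂ) * (Dᴴ *ᵥ u) (z, a, α)) +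
          ((D *ᵥ v) (z, a, α) - (χ z : ℂ) * (D *ᵥ u) (z, a, α)))‖ := by
        congr 1; ring
    _ ≤ (32 * (32 * S) + 32 * (A₁ * (32 * B₁))) + 1 * (4 * (A₂ * B₀ + 2 * (A₁ * B₁))) := by
        refine (norm_add_le _ _).trans (add_le_add hT1 ?_)
        rw [norm_mul]
        exact mul_le_mul hmn hT23 (norm_nonneg _) zero_le_one
    _ ≤ 2056 * S := by rw [hS]; nlinarith [mul_nonneg hA₁0 hB₁0, mul_nonneg hA₂0 hB₀0]

end Summit.QuantumFields.QCD.Cruxes.SmallFieldUltracontractivity.PointCentredAxialParabolic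

end
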